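import Summits.QuantumFields.BalabanUV.Beta.FP.NestedStepLawOneShotJets
import Summits.QuantumFields.BalabanUV.Beta.FP.TorusCombRows
import Summits.QuantumFields.BalabanUV.Beta.FP.ForestTriangularJets

/-!
# `BalabanUV.Beta.FP.CombSliceJetLetters` — road «FP» for binder row D1, ROUTE T, RULING R-FP-52 (2): THE FADDEEV–POPOV JET LETTERS OF THE OWNER's
# ANALYSIS-FREE ONE-SHOT STEP LAW (`NestedStepLawOneShotJets.secondVar_oneShot_nestedStepLaw_jets_of_uni`, p308750 ✓: `hPW`, `hTW`, `hUP`, `hUT`) FOR STATIC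
# GENERATORS (`W₁ = W₂ = 0` — the colour-stripped literal, `W₀ = tgrad`): the two FP second variations VANISH given the first and second covariance jets
# `Q₁₁W₀ = 0`, `Q₁₂W₀ = 0`, and the two FP operators are NON-DEGENERATE given unimodularity (`|det| = 1` from `TorusCombRows` ∕ `CombSliceUnimodular`)

HONEST DEPENDENCY (page 1, mandatory): continuum YM on T⁴ ⇐ BetaPertH ∧ nine spine estimates (0/9 proved); BetaPertH ⇐ (D1) ∧ (D4) ∧ CAP+tail;
G-an2-4 gates asym, D1 and NE2/3/4.  HONEST FRAMING (cell contract, verbatim): «discharging `BetaPertH` makes Bałaban's UV stability UNCONDITIONAL —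
a real constructive-QFT result; it is NOT the continuum limit and NOT the Clay problem.»  ABSOLUTE RULE (cell charter, verbatim): «No internally-minted
statement may enter as a cited fact. Every hypothesis is either kernel-proved in this package or a verbatim quotation of a PUBLISHED theorem with page
reference. The manuscript(s) under audit are NOT citable for their own disputed steps — they are the thing under adjudication; programme-internal
(2001/route/tribunal) claims are never citable.»  THIS MODULE is [folklore] finite-dimensional matrix algebra over BF-x's `LogDetSecondVariation.secondVar` and the
OWNER's `NestedStepLawOneShot.abs_det_nestedSlice_mul_gauge` (LEMMA N′); index-generic; no `def`, nothing cited, 0 sorry.  «not in print; our bookkeeping».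
(OWNER [D1P3-G17-LANDED-4] l.37157: «what remains for `hSDF` at finite j are the (T-ID) LETTERS against THIS file (… FP jet letters ○ leaf-06 first refusal …)».)

CONTENT (every index type).
* §1 `secondVar_zero_jets : secondVar A 0 0 = 0`; `det_ne_zero_of_abs_det_eq_one`.
* §2 **`hUP_of_static`**: `secondVar (P * W₀) (P * 0) (P * 0) = 0` — the one-shot FP second variation `hUP` at `W₁ = W₂ = 0`, NO hypothesis.
* §3 **`hUT_of_static`**: the nested FP second variation `hUT` at `W₁ = W₂ = 0`, in the OWNER's displayed shape
  `secondVar ([τ₂Q₁₀;τ₁]W₀) ([τ₂Q₁₁;0]W₀ + [τ₂Q₁₀;τ₁]·0) ([τ₂Q₁₂;0]W₀ + [τ₂Q₁₁;0]·0 + ([τ₂Q₁₁;0]·0 + [τ₂Q₁₀;τ₁]·0)) = 0`,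
  from the COVARIANCE JETS `Q₁₁W₀ = 0`,
  `Q₁₂W₀ = 0` (the first and second background jets of «the one-step averaging kills the residual generators» — for static generators the jets of
  `Q₁(u)·W = [D̄ | 0]`; gan24-leaf-05's (C1) family differentiated — their letters, DISPLAYED here).
* §5 TORUS SIDE: **`combRowsT_mul_forestTriangular`** — for ANY comb-local `D` (rows on the comb bond into `x` supported on the columns `x`, `stepOf x`) the product
  `combRowsT * D↾Res` is triangular along the comb forest in the OWNER's `h₀ h₁ h₂` shape (`site := id`, `parent := parentT`); `depth_parentT_id` the rank letter — so the
  MOVING-generator case of (v) reduces to per-site scalar identities `d₀d₂ = d₁²` (`ForestTriangularJets.secondVar_unique_eq_zero`, OWNER) once the dictionary displays `W₁ W₂`.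
* §6 **`secondVar_combRowsT_jets_eq_zero`** = § B (v) FOR THE COMB ROWS: three comb-local jets `D₀ D₁ D₂`, non-zero zeroth diagonal, per-site `d₀d₂ = d₁²` ⇒ `secondVar = 0`
  (the OWNER's `ForestTriangularJets.secondVar_forestTriangular_jets_eq_zero` + `secondVar_unique_eq_zero` composed with §5).
* §4 NON-DEGENERACY from unimodularity: **`hPW_of_abs_det_eq_one`** (`|det(P·W₀)| = 1 ⇒ det ≠ 0`), **`hTW_of_unimodular`**
  (`Q₁₀D₁ = 0`, `Q₁₀D₂ = D̄`, `|det(τ₁D₁)| = 1`, `|det(τ₂D̄)| = 1` ⇒ `det([τ₂Q₁₀;τ₁]·[D₂|D₁]) ≠ 0`, via LEMMA N′).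
0 estimates; 0∕4 row-D1 binders; NOT the covariance jets themselves (gan24-leaf-05 ∕ leaf-02 (T-ID)), NOT the instance, NOT SDF, NOT D1, NOT BetaPertH, NOT continuum, NOT Clay.
Provenance: D1 formalisation swarm LEAF PROVER 06, unit b2b-balaban-beta-d1-formalise-leaf-06 gen 16, 2026-08-21.  No existing file touched.
-/

noncomputable section

namespace Summit.QuantumFields.BalabanUV.Beta.FP.CombSliceJetLetters

open Matrix
open Summit.QuantumFields.BalabanUV.Beta.D1BFx.LogDetSecondVariation (secondVar)
open Summit.QuantumFields.BalabanUV.Beta.FP.NestedStepLawOneShot (abs_det_nestedSlice_mul_gauge)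

/-! ## §1 Two one-liners -/

section Basic

variable {ι : Type*} [Fintype ι] [DecidableEq ι]

/-- [folklore] **A 2-JET WITH VANISHING FIRST AND SECOND JETS HAS ZERO ONE-LOOP FUNCTIONAL**: `secondVar A 0 0 = 0`. -/
theorem secondVar_zero_jets (A : Matrix ι ι ℝ) : secondVar A 0 0 = 0 := by
  simp [secondVar]

/-- [folklore] unimodular ⇒ non-degenerate. -/
theorem det_ne_zero_of_abs_det_eq_one {A : Matrix ι ι ℝ} (h : |A.det| = 1) : A.det ≠ 0 := by
  intro h0; rw [h0, abs_zero] at h; exact zero_ne_one h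

end Basic

/-! ## §2 The one-shot FP second variation for static generators -/

section OneShot

variable {ν ρ : Type*} [Fintype ν] [Fintype ρ] [DecidableEq ρ]

/-- [folklore] **`hUP` FOR STATIC GENERATORS** (`W₁ = W₂ = 0`): `secondVar (P·W₀) (P·0) (P·0) = 0` — no hypothesis. -/
theorem hUP_of_static (P : Matrix ρ ν ℝ) (W₀ : Matrix ν ρ ℝ) :
    secondVar (P * W₀) (P * (0 : Matrix ν ρ ℝ)) (P * (0 : Matrix ν ρ ℝ)) = 0 := by
  rw [Matrix.mul_zero]; exact secondVar_zero_jets _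

/-- [folklore] **`hPW` FROM UNIMODULARITY**: `|det(P·W₀)| = 1 ⇒ det(P·W₀) ≠ 0`. -/
theorem hPW_of_abs_det_eq_one (P : Matrix ρ ν ℝ) (W₀ : Matrix ν ρ ℝ) (h : |(P * W₀).det| = 1) : (P * W₀).det ≠ 0 :=
  det_ne_zero_of_abs_det_eq_one h

end OneShot

/-! ## §3 The nested FP second variation for static generators, from the covariance jets -/

section Nested

variable {ν μ ρ₁ ρ₂ : Type*} [Fintype ν] [Fintype μ] [Fintype ρ₁] [Fintype ρ₂] [DecidableEq ρ₁] [DecidableEq ρ₂]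

omit [Fintype ρ₁] [Fintype ρ₂] [DecidableEq ρ₁] [DecidableEq ρ₂] in
/-- [folklore] a covariance jet `Q₁ⱼ·W₀ = 0` kills the corresponding jet of the nested slice's FP operator: `[τ₂Q₁ⱼ; 0]·W₀ = 0`. -/
theorem fromRows_mul_eq_zero_of_jet (τ₂ : Matrix ρ₂ μ ℝ) (Q : Matrix μ ν ℝ) (W₀ : Matrix ν (ρ₂ ⊕ ρ₁) ℝ) (h : Q * W₀ = 0) :
    fromRows (τ₂ * Q) (0 : Matrix ρ₁ ν ℝ) * W₀ = 0 := by
  rw [Matrix.fromRows_mul, Matrix.mul_assoc, h, Matrix.mul_zero, Matrix.zero_mul]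
  ext (i | i) j <;> rfl

/-- [folklore] **`hUT` FOR STATIC GENERATORS FROM THE COVARIANCE JETS** (the OWNER's displayed shape with `W₁ = W₂ = 0`): if `Q₁₁·W₀ = 0` and
`Q₁₂·W₀ = 0` then
the displayed nested FP 2-jet `([τ₂Q₁₀;τ₁]·W₀, [τ₂Q₁₁;0]·W₀ + [τ₂Q₁₀;τ₁]·0, [τ₂Q₁₂;0]·W₀ + …·0)` has `secondVar = 0`. -/
theorem hUT_of_static (τ₁ : Matrix ρ₁ ν ℝ) (τ₂ : Matrix ρ₂ μ ℝ) (Q₁₀ Q₁₁ Q₁₂ : Matrix μ ν ℝ) (W₀ : Matrix ν (ρ₂ ⊕ ρ₁) ℝ)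
    (h1 : Q₁₁ * W₀ = 0) (h2 : Q₁₂ * W₀ = 0) :
    secondVar (fromRows (τ₂ * Q₁₀) τ₁ * W₀)
        (fromRows (τ₂ * Q₁₁) (0 : Matrix ρ₁ ν ℝ) * W₀ + fromRows (τ₂ * Q₁₀) τ₁ * (0 : Matrix ν (ρ₂ ⊕ ρ₁) ℝ))
        (fromRows (τ₂ * Q₁₂) (0 : Matrix ρ₁ ν ℝ) * W₀ + fromRows (τ₂ * Q₁₁) (0 : Matrix ρ₁ ν ℝ) * (0 : Matrix ν (ρ₂ ⊕ ρ₁) ℝ)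
          + (fromRows (τ₂ * Q₁₁) (0 : Matrix ρ₁ ν ℝ) * (0 : Matrix ν (ρ₂ ⊕ ρ₁) ℝ)
            + fromRows (τ₂ * Q₁₀) τ₁ * (0 : Matrix ν (ρ₂ ⊕ ρ₁) ℝ))) = 0 := by
  rw [fromRows_mul_eq_zero_of_jet τ₂ Q₁₁ W₀ h1, fromRows_mul_eq_zero_of_jet τ₂ Q₁₂ W₀ h2, Matrix.mul_zero, Matrix.mul_zero]
  simp only [add_zero]
  exact secondVar_zero_jets _

/-- [folklore] **`hTW` FROM UNIMODULARITY** (LEMMA N′): `Q₁₀D₁ = 0`, `Q₁₀D₂ = D̄`, `|det(τ₁D₁)| = 1`, `|det(τ₂D̄)| = 1` ⇒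
`det([τ₂Q₁₀; τ₁]·[D₂|D₁]) ≠ 0`. -/
theorem hTW_of_unimodular (τ₁ : Matrix ρ₁ ν ℝ) (τ₂ : Matrix ρ₂ μ ℝ) (Q₁₀ : Matrix μ ν ℝ) (D₁ : Matrix ν ρ₁ ℝ) (D₂ : Matrix ν ρ₂ ℝ)
    (Dbar : Matrix μ ρ₂ ℝ) (h₁ : Q₁₀ * D₁ = 0) (h₂ : Q₁₀ * D₂ = Dbar) (hc₁ : |(τ₁ * D₁).det| = 1) (hc₂ : |(τ₂ * Dbar).det| = 1) :
    (fromRows (τ₂ * Q₁₀) τ₁ * fromCols D₂ D₁).det ≠ 0 := by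
  apply det_ne_zero_of_abs_det_eq_one
  rw [abs_det_nestedSlice_mul_gauge τ₁ τ₂ Q₁₀ D₁ D₂ Dbar h₁ h₂ hc₁ hc₂, mul_one]

end Nested

/-! ## §5 Torus side: the comb-coordinate rows against ANY comb-local matrix are triangular along the comb forest (the `h₀ h₁ h₂` shape of the jet lemma) -/

section Torus

open Literature.MathematicalPhysics.QuantumFieldTheory.Balaban1983to89
open Literature.MathematicalPhysics.QuantumFieldTheory.Balaban1983to89.Beta
open AffineAveraging (Site)
open B6Lemma24Torus (pbox)
open OneStepResolventKernel (Fib)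
open Summit.QuantumFields.BalabanUV.Beta.FP.KernelPeriodisationFib (Idx)
open Summit.QuantumFields.BalabanUV.Beta.FP.TorusCombForest
open Summit.QuantumFields.BalabanUV.Beta.FP.TorusCombRows

variable {d : ℕ} {ρ : Site (d + 1)} {N : ℕ} {M : Fin (d + 1) → ℕ}

/-- [folklore] **COMB-LOCAL COLUMNS ⇒ FOREST-TRIANGULAR ROWS** (the shape `h₀`∕`h₁`∕`h₂` of the OWNER's `ForestTriangularJets.secondVar_forestTriangular_jets` with `site := id`,
`parent := parentT`, `rk := depth ∘ site`): if every row of `D` on a comb bond INTO `x` is supported on the two columns `x` and its comb predecessor (a LOCALITY letter only —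
it holds for the zeroth generator `tgrad` and for any generator JET built bondwise from it), then `combRowsT ρ N M * D↾Res` has its `(x, s)` entry zero unless `s = x` or
`parentT x = some s`.  So the three FP jets `P·W₀, P·W₁, P·W₂` of the jets theorem are triangular along ONE forest, and (UNI) at jet level reduces to the per-site scalar
identity `d₀·d₂ = d₁²` (`ForestTriangularJets.secondVar_unique_eq_zero`). -/
theorem combRowsT_mul_forestTriangular (hN : 0 < N) (hρ : ∀ i, 0 ≤ ρ i ∧ ρ i < N) (hM : ∀ i, N ∣ M i) (D : Matrix (Idx M (Fib d)) ↥(pbox M) ℝ)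
    (hDloc : ∀ (x : Res ρ N M) (s : ↥(pbox M)), D (combBondT ρ N M x) s ≠ 0 →
      (s : Site (d + 1)) = x.site ∨ (s : Site (d + 1)) = stepOf ρ N x.site)
    (i j : Res ρ N M) (h : (combRowsT ρ N M * D.submatrix id Subtype.val) i j ≠ 0) : id j = id i ∨ parentT ρ N M i = some (id j) := by
  rw [combRowsT_mul_apply, Matrix.submatrix_apply] at h
  rcases hDloc i j.1 h with h1 | h1
  · exact Or.inl ((Res.ext_iff' j i).2 h1)
  · exact Or.inr ((parentT_eq_some_iff hN hρ hM i j).2 h1)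

/-- [folklore] the rank letter of the comb forest in the OWNER's shape (`site := id`): `parentT x = some p → depth p < depth x`. -/
theorem depth_parentT_id (hN : 0 < N) (hρ : ∀ i, 0 ≤ ρ i ∧ ρ i < N) (hM : ∀ i, N ∣ M i) (x p : Res ρ N M) (h : parentT ρ N M x = some p) :
    (fun y : Res ρ N M => depth ρ N y.site) (id p) < (fun y : Res ρ N M => depth ρ N y.site) x :=
  depth_parentT hN hρ hM x p h

end Torus

/-! ## §6 (UNI) at jet level for the comb rows: three comb-local jets + the per-site scalar identity ⇒ `secondVar = 0` (the OWNER's `ForestTriangularJets` composed) -/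

section TorusJets

open Literature.MathematicalPhysics.QuantumFieldTheory.Balaban1983to89
open Literature.MathematicalPhysics.QuantumFieldTheory.Balaban1983to89.Beta
open AffineAveraging (Site)
open B6Lemma24Torus (pbox)
open OneStepResolventKernel (Fib)
open Summit.QuantumFields.BalabanUV.Beta.FP.KernelPeriodisationFib (Idx)
open Summit.QuantumFields.BalabanUV.Beta.FP.TorusCombForest
open Summit.QuantumFields.BalabanUV.Beta.FP.TorusCombRows
open Summit.QuantumFields.BalabanUV.Beta.FP.ForestTriangularJets (secondVar_forestTriangular_jets_eq_zero secondVar_unique_eq_zero)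

variable {d : ℕ} {ρ : Site (d + 1)} {N : ℕ} {M : Fin (d + 1) → ℕ}

/-- [folklore] the diagonal entry of `combRowsT * D↾Res` at `x` is `D`'s entry on the comb bond into `x`, column `x`. -/
theorem combRowsT_mul_diag (D : Matrix (Idx M (Fib d)) ↥(pbox M) ℝ) (x : Res ρ N M) :
    (combRowsT ρ N M * D.submatrix id Subtype.val) x x = D (combBondT ρ N M x) x.1 := by
  rw [combRowsT_mul_apply, Matrix.submatrix_apply]; rfl

/-- [folklore] the entry of a 1×1 site block (`site := id`) at its unique index is the diagonal entry. -/
theorem toSquareBlock_id_default {t : Type*} (A : Matrix t t ℝ) (x : t) [Unique {a : t // id a = x}] :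
    (A.toSquareBlock id x) default default = A x x := by
  have h : ((default : {a : t // id a = x}) : t) = x := (default : {a : t // id a = x}).2
  rw [Matrix.toSquareBlock_def, Matrix.of_apply, h]

/-- [folklore] **(UNI) AT JET LEVEL FOR THE COMB-COORDINATE ROWS** (TID-LETTER-SPEC § B (v), torus side; the OWNER's `ForestTriangularJets.secondVar_forestTriangular_jets_eq_zero`
+ `secondVar_unique_eq_zero` composed with `combRowsT_mul_forestTriangular`): if the three generator jets `D₀ D₁ D₂` are COMB-LOCAL (rows on the comb bond into `x` supported on
the columns `x`, `stepOf x`), the zeroth has non-zero diagonal entries, and the per-site scalar identity `d₀(x)·d₂(x) = d₁(x)²` holds for the diagonal entries on the comb bond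
into each `x`, then `secondVar (combRowsT·D₀↾Res) (combRowsT·D₁↾Res) (combRowsT·D₂↾Res) = 0` — the shape of `hUP` (and, at the nested rows, of `hUT`) of the jets theorem. -/
theorem secondVar_combRowsT_jets_eq_zero (hN : 0 < N) (hρ : ∀ i, 0 ≤ ρ i ∧ ρ i < N) (hM : ∀ i, N ∣ M i) (D₀ D₁ D₂ : Matrix (Idx M (Fib d)) ↥(pbox M) ℝ)
    (h₀ : ∀ (x : Res ρ N M) (s : ↥(pbox M)), D₀ (combBondT ρ N M x) s ≠ 0 → (s : Site (d + 1)) = x.site ∨ (s : Site (d + 1)) = stepOf ρ N x.site)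
    (h₁ : ∀ (x : Res ρ N M) (s : ↥(pbox M)), D₁ (combBondT ρ N M x) s ≠ 0 → (s : Site (d + 1)) = x.site ∨ (s : Site (d + 1)) = stepOf ρ N x.site)
    (h₂ : ∀ (x : Res ρ N M) (s : ↥(pbox M)), D₂ (combBondT ρ N M x) s ≠ 0 → (s : Site (d + 1)) = x.site ∨ (s : Site (d + 1)) = stepOf ρ N x.site)
    (hd : ∀ x : Res ρ N M, D₀ (combBondT ρ N M x) x.1 ≠ 0)
    (hsq : ∀ x : Res ρ N M, D₀ (combBondT ρ N M x) x.1 * D₂ (combBondT ρ N M x) x.1 = D₁ (combBondT ρ N M x) x.1 ^ 2) :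
    secondVar (combRowsT ρ N M * D₀.submatrix id Subtype.val) (combRowsT ρ N M * D₁.submatrix id Subtype.val)
      (combRowsT ρ N M * D₂.submatrix id Subtype.val) = 0 := by
  refine secondVar_forestTriangular_jets_eq_zero _ _ _ id (fun y : Res ρ N M => depth ρ N y.site) (parentT ρ N M)
    (fun x p h => depth_parentT hN hρ hM x p h) (combRowsT_mul_forestTriangular hN hρ hM D₀ h₀) (combRowsT_mul_forestTriangular hN hρ hM D₁ h₁)
    (combRowsT_mul_forestTriangular hN hρ hM D₂ h₂) (fun x _ => ?_) (fun x _ => ?_)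
  · -- the 1×1 block at `x` has determinant its entry
    haveI : Unique {a : Res ρ N M // id a = x} := ⟨⟨⟨x, rfl⟩⟩, fun a => Subtype.ext a.2⟩
    rw [Matrix.det_eq_elem_of_subsingleton _ default, toSquareBlock_id_default, combRowsT_mul_diag]
    exact hd x
  · haveI : Unique {a : Res ρ N M // id a = x} := ⟨⟨⟨x, rfl⟩⟩, fun a => Subtype.ext a.2⟩
    refine secondVar_unique_eq_zero _ _ _ ?_ ?_
    · rw [toSquareBlock_id_default, combRowsT_mul_diag]; exact hd x
    · rw [toSquareBlock_id_default, toSquareBlock_id_default, toSquareBlock_id_default, combRowsT_mul_diag, combRowsT_mul_diag, combRowsT_mul_diag]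
      exact hsq x

end TorusJets

end Summit.QuantumFields.BalabanUV.Beta.FP.CombSliceJetLetters

end
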